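import Literature.Computability.Complexity.ScaledPCPTapeFP
import Literature.Computability.Complexity.TableauCSPEval
import HarnessLib

/-!
# The query map of the scaled PCP verifier with residues (spec level)

Literature / complexity toolkit, third MACHINE-LAYER brick for `ScaledPCP.verifier' M T`
(`ScaledPCPVerifier.lean`). Its query map `queriesOf x ρ` lists, on good coins, the `b₀`-bit blocks
of the oracle at the points of the low-degree tests (`ldtList`) and of the self-corrected reads
(`scList`), then the coefficient blocks of the `K` sumcheck messages along the challenge prefixes
(`msgQueries (msgArgs τ)`) — all defined over the field `ZMod p` and the structured tape. This file
restates the map over RESIDUE LISTS (`ScaledPCPTapeFP.lean`: the tape as the parse `coinParse`;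
`TableauCSPEval.lean`: the read addresses `TabEval.addrN` of the descriptor list `TabEval.descs`)
and proves the two equal:

* `vecIdxN` (`= vecIdx`, `vecIdx_eq_vecIdxN`), `linPtN` (the point `a + j • c` on residues),
  `PtRel` (a field point and its residue list, `ptRel_linPt`), `flatten_getD_blocks` /
  `flatten_getD_sigma` (indexing the flattened read-address table by `finSigmaFinEquiv`);
* `ldtN`, `scN`, `ptsN`, `ptQN`, `sIdxN`, `msgQN` and **`queriesN`** — the residue-level query
  list from the parameters, the input `x`, the residue tape and the descriptors — with
  **`queriesOf_eq_queriesN : queriesOf M T x ρ = queriesN M T x ρ`**.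

The polynomial running time of `queriesN` (assembled from the programmes of the previous bricks) is
the sequel `ScaledPCPQueriesFP.lean`. All proved; no named fact.

## References

* L. Babai, L. Fortnow, L. Levin, M. Szegedy, *Checking computations in polylogarithmic time*,
  STOC 1991, §5 (what the verifier reads) [BFLS1991].
* S. Arora, B. Barak, *Computational Complexity: A Modern Approach*, CUP 2009, Def. 11.4
  (nonadaptive queries), §8.6, §11.5 [AroraBarakCC2009].
-/

noncomputable section

open Finset Polynomial

namespace Literature.Computability.Complexity

namespace ScaledPCP

open CodeFP Turing Tableau TableauCSP AlgebraicPCP LowDegreeTest ModArith TabEval _root_.Computability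

attribute [local instance] Turing.FinTM2.kFin Turing.FinTM2.ΛFin Turing.FinTM2.σFin
  Turing.FinTM2.Γk₀Fin

/-! ### Indices of residue vectors, points on lines -/

/-- **The base-`p` index of a residue list** `∑ₜ w[t] pᵗ`. [folklore] -/
def vecIdxN (p : ℕ) (w : List ℕ) : ℕ := (((List.range w.length).zip w).map fun ta => ta.2 * p ^ ta.1).sum

/-- `vecIdxN` as a `Finset.range` sum. [folklore] -/
theorem vecIdxN_eq (p : ℕ) (w : List ℕ) : vecIdxN p w = ∑ t ∈ range w.length, w.getD t 0 * p ^ t := by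
  unfold vecIdxN
  rw [← sum_map_range]
  congr 1
  apply List.ext_getElem
  · simp
  · intro i h1 h2
    rw [List.length_map, List.length_range] at h2
    rw [List.getElem_map, List.getElem_map, List.getElem_range]
    simp only [List.getElem_zip, List.getElem_range]
    rw [List.getD_eq_getElem _ _ h2]

/-- `vecIdxN` as a sum over a longer range (the entries beyond the list are `0`). [folklore] -/
theorem vecIdxN_eq_sum_range {N : ℕ} (p : ℕ) (w : List ℕ) (hN : w.length ≤ N) :
    vecIdxN p w = ∑ t ∈ range N, w.getD t 0 * p ^ t := by
  rw [vecIdxN_eq, ← sum_range_add_sum_Ico _ hN]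
  rw [sum_eq_zero (s := Ico w.length N) fun t ht => by rw [List.getD_eq_default _ _ (mem_Ico.1 ht).1, zero_mul], add_zero]

/-- **A field point and its residue list**: same length, coordinatewise `val`. [folklore] -/
def PtRel {p m : ℕ} (w : Fin m → ZMod p) (wl : List ℕ) : Prop := wl.length = m ∧ ∀ u : Fin m, (w u).val = wl.getD (u : ℕ) 0

/-- The point `a + j • c` on residues. [folklore] -/
def linPtN (p : ℕ) (a c : List ℕ) (j : ℕ) : List ℕ := List.zipWith (fun u v => addM p u (mulM p j v)) a c

/-- **`x + j • t` on residues.** [folklore] -/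
theorem ptRel_linPt {p : ℕ} [Fact p.Prime] {m : ℕ} {X Td : Fin m → ZMod p} {a c : List ℕ} (hX : PtRel X a) (hT : PtRel Td c)
    {j : ℕ} (hj : j < p) : PtRel (X + ((j : ℕ) : ZMod p) • Td) (linPtN p a c j) := by
  refine ⟨by rw [linPtN, List.length_zipWith, hX.1, hT.1, min_self], fun u => ?_⟩
  rw [linPtN, List.getD_eq_getElem _ _ (by rw [List.length_zipWith, hX.1, hT.1, min_self]; exact u.2), List.getElem_zipWith]
  simp only [Pi.add_apply, Pi.smul_apply, smul_eq_mul]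
  rw [ZMod.val_add, ZMod.val_mul, ZMod.val_natCast, Nat.mod_eq_of_lt hj, hX.2 u, hT.2 u,
    List.getD_eq_getElem _ _ (by rw [hX.1]; exact u.2), List.getD_eq_getElem _ _ (by rw [hT.1]; exact u.2)]
  rfl

/-- **`vecIdx` on residues.** [folklore] -/
theorem vecIdx_eq_vecIdxN (M : TM2ComputableAux Bool Bool) (T : ℕ → ℕ) (n : ℕ) {k : ℕ} {w : Fin k → FF M T n} {wl : List ℕ}
    (h : PtRel w wl) : vecIdx M T n w = vecIdxN (pN M T n) wl := by
  unfold vecIdx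
  rw [vecIdxN_eq, h.1, ← Fin.sum_univ_eq_sum_range]
  exact Fintype.sum_congr _ _ fun t => by rw [h.2 t]

/-- A residue list recovered from its `getD`s. [folklore] -/
theorem ofFn_getD_eq {α : Type} {k : ℕ} (l : List α) (hl : l.length = k) (d : α) : (List.ofFn fun q : Fin k => l.getD (q : ℕ) d) = l := by
  apply List.ext_getElem
  · simp [hl]
  · intro i h1 h2
    rw [List.getElem_ofFn, List.getD_eq_getElem _ _ h2]

/-! ### Indexing a flattened table of blocks -/

/-- Indexing a flattened list of blocks at block `i`, offset `j`. [folklore] -/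
theorem flatten_getD_blocks {α : Type*} (d : α) : ∀ (L : List (List α)) (i : ℕ) (j : ℕ), j < (L.getD i []).length →
    L.flatten.getD (((L.take i).map List.length).sum + j) d = (L.getD i []).getD j d
  | [], i, j, hj => absurd hj (by simp)
  | l :: L, 0, j, hj => by
    have hj' : j < l.length := by simpa using hj
    rw [List.take_zero, List.map_nil, List.sum_nil, Nat.zero_add, List.flatten_cons, List.getD_cons_zero,
      List.getD_eq_getElem?_getD, List.getElem?_append_left hj', ← List.getD_eq_getElem?_getD]
  | l :: L, i + 1, j, hj => by
    have hj' : j < (L.getD i []).length := by simpa using hj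
    rw [List.take_succ_cons, List.map_cons, List.sum_cons, List.flatten_cons, List.getD_eq_getElem?_getD, Nat.add_assoc,
      List.getElem?_append_right (Nat.le_add_right _ _), Nat.add_sub_cancel_left, ← List.getD_eq_getElem?_getD, List.getD_cons_succ]
    exact flatten_getD_blocks d L i j hj'

/-- The block offsets of `finSigmaFinEquiv`: `∑_{i' < i} ar i'` is the total length of the first `i` blocks. [folklore] -/
theorem sum_take_lengths {α : Type*} {k : ℕ} {ar : Fin k → ℕ} (L : List (List α)) (hL : L.length = k)
    (hlen : ∀ i : Fin k, (L.getD i []).length = ar i) (i : Fin k) :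
    ((L.take i).map List.length).sum = ∑ i' : Fin i, ar (Fin.castLE i.2.le i') := by
  rw [← List.sum_ofFn]
  congr 1
  apply List.ext_getElem
  · simp [hL]
  · intro t h1 h2
    rw [List.length_ofFn] at h2
    rw [List.getElem_map, List.getElem_take, List.getElem_ofFn]
    have := hlen ⟨t, by omega⟩
    rw [List.getD_eq_getElem _ _ (by rw [hL]; omega)] at this
    exact this

/-- **Indexing the flattened table of blocks by `finSigmaFinEquiv ⟨i, j⟩`** gives entry `j` of block `i`.
[Mathlib `finSigmaFinEquiv_apply`] [folklore] -/
theorem flatten_getD_sigma {α : Type*} {k : ℕ} {ar : Fin k → ℕ} (L : List (List α)) (hL : L.length = k)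
    (hlen : ∀ i : Fin k, (L.getD i []).length = ar i) (d : α) (i : Fin k) (j : Fin (ar i)) :
    L.flatten.getD (finSigmaFinEquiv (⟨i, j⟩ : (i : Fin k) × Fin (ar i))) d = (L.getD i []).getD j d := by
  rw [finSigmaFinEquiv_apply]
  dsimp only
  rw [← sum_take_lengths L hL hlen i]
  exact flatten_getD_blocks d L i j (by rw [hlen]; exact j.2)

/-! ### List plumbing -/

/-- Equal `flatMap`s along related lists. [folklore] -/
theorem flatMap_eq_of_forall₂ {α β γ : Type*} {R : α → β → Prop} {f : α → List γ} {g : β → List γ} (hfg : ∀ a b, R a b → f a = g b) :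
    ∀ {l : List α} {l' : List β}, List.Forall₂ R l l' → l.flatMap f = l'.flatMap g
  | _, _, List.Forall₂.nil => rfl
  | _, _, List.Forall₂.cons h hl => by rw [List.flatMap_cons, List.flatMap_cons, hfg _ _ h, flatMap_eq_of_forall₂ hfg hl]

/-- `flatMap` over `finRange` through `val` is `flatMap` over `range`. [folklore] -/
theorem flatMap_finRange {γ : Type*} (k : ℕ) (f : ℕ → List γ) : (List.finRange k).flatMap (fun i : Fin k => f i) = (List.range k).flatMap f := by
  rw [← List.map_coe_finRange_eq_range, List.flatMap_map]

/-- `map` over `finRange` through `val` is `map` over `range`. [folklore] -/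
theorem map_finRange {γ : Type*} (k : ℕ) (f : ℕ → γ) : (List.finRange k).map (fun i : Fin k => f i) = (List.range k).map f := by
  rw [← List.map_coe_finRange_eq_range, List.map_map]; rfl

/-! ### The residue-level query list -/

section Queries

variable (M : TM2ComputableAux Bool Bool) (T : ℕ → ℕ) (x : List Bool) (ρc : List Bool)

local notation "n" => x.length
local notation "p" => pN M T x.length
local notation "𝔽" => FF M T x.length
local notation "KK" => KN M T x.length
local notation "mm" => mN M T x.length
local notation "CC" => CN M T x.length x
local notation "d" => dM M

/-- The residue tape of the coins. [folklore] -/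
def tvOf : List ℕ := (coinParse (bN M T n) p (kT M T x) ρc).2

/-- The read addresses of all reads of all families at the challenges `r`, flattened along the read
enumeration. [cite: BFLS1991, §5] -/
def addrsFlat (tv : List ℕ) : List (List ℕ) :=
  ((descs M n 0 (T n) x).map fun fd => fd.2.1.map fun rd => addrN (hN M n) (ktN M T n) (kJN M T n) (rN KK tv) rd).flatten

/-- The `m` residues of the `q`-th read address. [folklore] -/
def rdPtN (tv : List ℕ) (q : ℕ) : List ℕ := (List.range mm).map fun u => ((addrsFlat M T x tv).getD q []).getD u 0 % p

/-- The points of the low-degree tests. [cite: RubinfeldSudan1996, §4] -/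
def ldtN (tv : List ℕ) : List (List ℕ) :=
  (List.range (TtN M T n)).flatMap fun i => (List.range (dN M T n + 2)).map fun j =>
    linPtN p (testX KK mm tv i) (testT KK mm tv i) j

/-- The points of the self-corrected reads. [cite: AroraBarakCC2009, §8.6.2] -/
def scN (tv : List ℕ) : List (List ℕ) :=
  (List.range (2 * n + cQ M)).flatMap fun q' => (List.range (dN M T n + 1)).map fun i =>
    linPtN p (rdPtN M T x tv q') (dirN KK mm (TtN M T n) tv q') (i + 1)

/-- All oracle points read. [folklore] -/
def ptsN (tv : List ℕ) : List (List ℕ) := ldtN M T x tv ++ scN M T x tv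

/-- The bit positions of a list of oracle points. [folklore] -/
def ptQN (pts : List (List ℕ)) : List ℕ := pts.flatMap fun w => (List.range (b0 M T n)).map fun i => vecIdxN p w * b0 M T n + i

/-- The index of the `i`-th message argument `(ρ, λ, r₁ … rᵢ)`. [folklore] -/
def sIdxN (tv : List ℕ) (i : ℕ) : ℕ :=
  ((vecIdxN p (rhoN KK tv) * p + seedN KK tv) * (KK + 1) + i) * p ^ KK + vecIdxN p ((rN KK tv).take i)

/-- The bit positions of the messages read. [folklore] -/
def msgQN (tv : List ℕ) : List ℕ :=
  (List.range KK).flatMap fun i => (List.range (DN M T n + 1)).flatMap fun j => (List.range (b0 M T n)).map fun i' =>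
    baseS M T n + (sIdxN M T x tv i * (DN M T n + 1) + j) * b0 M T n + i'

/-- **The residue-level query list.** [cite: BFLS1991, §5] -/
def queriesN : List ℕ :=
  if (coinParse (bN M T n) p (kT M T x) ρc).1 then
    ptQN M T x (ptsN M T x (tvOf M T x ρc)) ++ msgQN M T x (tvOf M T x ρc)
  else []

/-! ### The bridge -/

variable {x}

local notation "τ" => tapeOf M T x ρc
local notation "tv" => tvOf M T x ρc

/-- The tape length dominates the offsets of the test points. [folklore] -/
theorem off_test_le {i : ℕ} (hi : i < TtN M T n) : KK + 1 + KK + (mm + mm) * i + mm + mm ≤ kT M T x := by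
  show _ ≤ KK + (1 + (KK + (TtN M T n * (mm + mm) + nQry CC * mm)))
  have : (mm + mm) * i + (mm + mm) ≤ TtN M T n * (mm + mm) := by
    calc (mm + mm) * i + (mm + mm) = (mm + mm) * (i + 1) := by ring
      _ ≤ (mm + mm) * TtN M T n := Nat.mul_le_mul_left _ hi
      _ = TtN M T n * (mm + mm) := Nat.mul_comm _ _
  omega

/-- The tape length dominates the offsets of the directions. [folklore] -/
theorem off_dir_le {q : ℕ} (hq : q < nQry CC) : KK + 1 + KK + TtN M T n * (mm + mm) + mm * q + mm ≤ kT M T x := by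
  show _ ≤ KK + (1 + (KK + (TtN M T n * (mm + mm) + nQry CC * mm)))
  have : mm * q + mm ≤ nQry CC * mm := by
    calc mm * q + mm = mm * (q + 1) := by ring
      _ ≤ mm * nQry CC := Nat.mul_le_mul_left _ hq
      _ = nQry CC * mm := Nat.mul_comm _ _
  omega

/-- Length of the residue tape. [folklore] -/
theorem length_tv : (tv).length = kT M T x := length_coinParse_snd _ _ _ _

/-- `ρ` of the tape. [folklore] -/
theorem ptRel_rho : PtRel (τ).ρ (rhoN KK tv) := by
  refine ⟨?_, fun t => val_rho CC _ _ _ t⟩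
  rw [rhoN, List.length_take, length_tv]
  exact min_eq_left (by show KK ≤ KK + _; omega)

/-- `r` of the tape. [folklore] -/
theorem ptRel_r : PtRel (τ).r (rN KK tv) := by
  refine ⟨?_, fun t => val_r CC _ _ _ t⟩
  rw [rN, List.length_take, List.length_drop, length_tv]
  exact min_eq_left (by show KK ≤ KK + (1 + (KK + _)) - (KK + 1); omega)

/-- Base points of the tests. [folklore] -/
theorem ptRel_testX (i : Fin (TtN M T n)) : PtRel ((τ).tests i).1 (testX KK mm tv i) := by
  refine ⟨?_, fun u => val_testX CC _ _ _ i u⟩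
  rw [testX, List.length_take, List.length_drop, length_tv]
  have := off_test_le M T (x := x) i.2
  exact min_eq_left (by omega)

/-- Directions of the tests. [folklore] -/
theorem ptRel_testT (i : Fin (TtN M T n)) : PtRel ((τ).tests i).2 (testT KK mm tv i) := by
  refine ⟨?_, fun u => val_testT CC _ _ _ i u⟩
  rw [testT, List.length_take, List.length_drop, length_tv]
  have := off_test_le M T (x := x) i.2
  exact min_eq_left (by omega)

/-- Directions of the reads. [folklore] -/
theorem ptRel_dirs (q : (CC).Qry) : PtRel ((τ).dirs q) (dirN KK mm (TtN M T n) tv (qryEquiv CC q)) := by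
  refine ⟨?_, fun u => val_dirs CC _ _ _ q u⟩
  rw [dirN, List.length_take, List.length_drop, length_tv]
  have := off_dir_le M T (x := x) (qryEquiv CC q).2
  exact min_eq_left (by omega)

/-- The residues of the challenges are the residue list `rN`. [folklore] -/
theorem zlOf_r : zlOf M (LN M T n) (τ).r = rN KK tv := by
  unfold zlOf
  have h := ptRel_r M T ρc (x := x)
  rw [show (fun q : Fin (KIdx (LN M T n) d) => ((τ).r q).val) = fun q : Fin (KIdx (LN M T n) d) => (rN KK tv).getD (q : ℕ) 0
    from funext h.2]
  exact ofFn_getD_eq _ h.1 0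

/-- The table of read addresses has one block per family, of length the arity. [folklore] -/
theorem addrsFlat_blocks :
    ((descs M n 0 (T n) x).map fun fd => fd.2.1.map fun rd => addrN (hN M n) (ktN M T n) (kJN M T n) (rN KK tv) rd).length = (CC).N ∧
    ∀ φ : Fin (CC).N, ((((descs M n 0 (T n) x).map fun fd => fd.2.1.map fun rd =>
      addrN (hN M n) (ktN M T n) (kJN M T n) (rN KK tv) rd).getD φ []).length) = ((CC).fam φ).arity := by
  have hh : (LN M T n).h ≤ p := (hN_lt_pN M T (x := x)).le
  refine ⟨by rw [List.length_map]; exact length_descs (M := M) (L := LN M T n) (P := 0) (T := T n) hh x, fun φ => ?_⟩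
  rw [show ([] : List (List ℕ)) = (fun fd : FamDesc => fd.2.1.map fun rd => addrN (hN M n) (ktN M T n) (kJN M T n) (rN KK tv) rd)
    (0, [], [], []) from rfl, List.getD_map, List.length_map]
  exact (arity_eq (M := M) (L := LN M T n) (P := 0) (T := T n) hh x φ).symm

/-- **The `q`-th read address on residues is the read address of the analysis.** [cite: BFLS1991, §5] -/
theorem ptRel_rdPt (q : (CC).Qry) :
    PtRel (readAddr (((CC).fam q.1).addr q.2) (τ).r) (rdPtN M T x tv (qryEquiv CC q)) := by
  have hh : (LN M T n).h ≤ p := (hN_lt_pN M T (x := x)).le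
  obtain ⟨φ, j⟩ := q
  refine ⟨by simp [rdPtN], fun u => ?_⟩
  dsimp only
  have e : readAddr (((CC).fam φ).addr j) (τ).r = _ := readAddr_eq_addrN (M := M) (L := LN M T n) (P := 0) (T := T n) hh x (τ).r φ j
  rw [rdPtN, List.getD_eq_getElem _ _ (by simp), List.getElem_map, List.getElem_range, e, zlOf_r]
  dsimp only
  rw [ZMod.val_natCast]
  -- the flattened table at `qryEquiv ⟨φ, j⟩` is the address of read `j` of family `φ`
  obtain ⟨hL, hlen⟩ := addrsFlat_blocks M T ρc (x := x)
  have hj : (j : ℕ) < ((descs M n 0 (T n) x).getD φ (0, [], [], [])).2.1.length := by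
    rw [← arity_eq (M := M) (L := LN M T n) (P := 0) (T := T n) hh x φ]; exact j.2
  have key : (addrsFlat M T x tv).getD (qryEquiv CC ⟨φ, j⟩) [] =
      addrN (hN M n) (ktN M T n) (kJN M T n) (rN KK tv) ((((descs M n 0 (T n) x).getD φ (0, [], [], [])).2.1)[(j : ℕ)]'hj) := by
    unfold addrsFlat
    rw [show qryEquiv CC ⟨φ, j⟩ = finSigmaFinEquiv ⟨φ, j⟩ from rfl, flatten_getD_sigma _ hL hlen [] φ j,
      show ([] : List (List ℕ)) = (fun fd : FamDesc => fd.2.1.map fun rd => addrN (hN M n) (ktN M T n) (kJN M T n) (rN KK tv) rd)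
        (0, [], [], []) from rfl, List.getD_map, List.getD_eq_getElem _ _ (by rw [List.length_map]; exact hj), List.getElem_map]
  rw [key, List.getD_eq_getElem _ _ hj]
  rfl

/-- **The test points on residues.** [folklore] -/
theorem forall₂_ldt : List.Forall₂ PtRel (ldtList M T x τ) (ldtN M T x tv) := by
  unfold ldtList ldtN
  rw [← flatMap_finRange]
  refine forall₂_flatMap_flatMap _ fun i _ => forall₂_map_map _ fun j hj => ?_
  have hjp : j < p := by
    have := dN_succ_lt_pN M T (x := x); have := List.mem_range.1 hj; omega
  exact ptRel_linPt (ptRel_testX M T ρc i) (ptRel_testT M T ρc i) hjp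

/-- **The self-correction points on residues.** [folklore] -/
theorem forall₂_sc : List.Forall₂ PtRel (scList M T x τ) (scN M T x tv) := by
  unfold scList scN
  rw [← card_qry M T (x := x), show Fintype.card (CC).Qry = nQry CC by unfold nQry; simp [CSP.Qry, Fintype.card_sigma],
    ← flatMap_finRange]
  refine forall₂_flatMap_flatMap _ fun q' _ => ?_
  rw [← map_finRange]
  refine forall₂_map_map _ fun i _ => ?_
  have hip : (i : ℕ) + 1 < p := by
    have := dN_succ_lt_pN M T (x := x); have := i.2; omega
  have h1 := ptRel_rdPt M T ρc (x := x) ((qryEquiv CC).symm q')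
  have h2 := ptRel_dirs M T ρc (x := x) ((qryEquiv CC).symm q')
  rw [Equiv.apply_symm_apply] at h1 h2
  have := ptRel_linPt h1 h2 hip
  simpa [scNode] using this

/-- **The bit positions of related points agree.** [folklore] -/
theorem ptQueries_eq {pts : List (Fin mm → 𝔽)} {ptsl : List (List ℕ)} (h : List.Forall₂ PtRel pts ptsl) :
    ptQueries M T x pts = ptQN M T x ptsl := by
  unfold ptQueries ptQN
  refine flatMap_eq_of_forall₂ (fun w wl hw => ?_) h
  unfold posY
  rw [vecIdx_eq_vecIdxN M T n hw]

/-- **The index of a message argument on residues.** [folklore] -/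
theorem sIdx_eq {i : ℕ} (hi : i < KK) : sIdx M T n (τ).ρ (τ).seed ((List.ofFn (τ).r).take i) = sIdxN M T x tv i := by
  unfold sIdx sIdxN
  rw [vecIdx_eq_vecIdxN M T n (ptRel_rho M T ρc (x := x)), show (τ).seed.val = seedN KK tv from val_seed CC _ _ _, List.length_take,
    List.length_ofFn, min_eq_left hi.le]
  congr 1
  -- the padded prefix
  have hr := ptRel_r M T ρc (x := x)
  unfold vecIdx
  rw [vecIdxN_eq_sum_range (N := KK) _ _ (by rw [List.length_take, hr.1]; exact min_le_right _ _), ← Fin.sum_univ_eq_sum_range]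
  refine Fintype.sum_congr _ _ fun t => ?_
  unfold prefVec
  congr 1
  by_cases ht : (t : ℕ) < i
  · rw [TabEval.getD_take_of_lt _ ht, TabEval.getD_take_of_lt _ ht, TabEval.getD_ofFn, hr.2 t]
  · rw [List.getD_eq_default _ _ (by rw [List.length_take, List.length_ofFn]; omega),
      List.getD_eq_default _ _ (by rw [List.length_take, hr.1]; omega), ZMod.val_zero]

/-- Equal `flatMap`s on equal values along the list. [folklore] -/
theorem flatMap_congr_mem {α β : Type*} {f g : α → List β} : ∀ {l : List α}, (∀ a ∈ l, f a = g a) → l.flatMap f = l.flatMap g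
  | [], _ => rfl
  | a :: l, h => by rw [List.flatMap_cons, List.flatMap_cons, h a (by simp), flatMap_congr_mem fun b hb => h b (by simp [hb])]

/-- **The message positions on residues.** [folklore] -/
theorem msgQueries_eq : msgQueries M T x τ (msgArgs M T x τ) = msgQN M T x tv := by
  unfold msgQueries msgArgs msgQN
  rw [List.flatMap_map]
  refine flatMap_congr_mem fun i hi => flatMap_congr_mem fun j _ => List.map_congr_left fun i' _ => ?_
  unfold posS
  rw [sIdx_eq M T ρc (List.mem_range.1 hi)]

/-- **The query map of the verifier is the residue-level query list.**
[cite: BFLS1991, §5] [cite: AroraBarakCC2009, Def. 11.4] -/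
theorem queriesOf_eq_queriesN : queriesOf M T x ρc = queriesN M T x ρc := by
  unfold queriesOf queriesN
  by_cases hg : GoodCoins M T x ρc
  · have hg' : (coinParse (bN M T n) p (kT M T x) ρc).1 = true := (coinParse_fst _ _ _ _).2 hg
    have hpts : List.Forall₂ PtRel (ptsList M T x τ) (ptsN M T x tv) :=
      List.rel_append (forall₂_ldt M T ρc (x := x)) (forall₂_sc M T ρc (x := x))
    rw [if_pos hg, if_pos hg', ptQueries_eq M T hpts, msgQueries_eq]
  · have hg' : ¬ (coinParse (bN M T n) p (kT M T x) ρc).1 = true := fun h => hg ((coinParse_fst _ _ _ _).1 h)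
    rw [if_neg hg, if_neg hg']

end Queries

end ScaledPCP

end Literature.Computability.Complexity

end
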